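import Literature.NumberTheory.Rogawski1990.ArchOrbFamGExtCornerPeeling        -- ★ (X3-asm) (this seat): `contDiffOn_and_forall_bound_nestedReader` (the peeling induction)
import Literature.NumberTheory.Rogawski1990.ArchOrbFamGExtMultiWallJetBounds  -- ★ p851221 (X1) (this seat): `exists_nhds_bddAbove_norm_iteratedFDeriv_orbFamGExt_of_multiWallModel`
import Literature.NumberTheory.Rogawski1990.ArchOrbFamGExtCornerDress          -- ★ p851251 (D) (LH3-p02 (g4)): `exists_cornerBracket`
import Literature.NumberTheory.Automorphic.ArchCayleyTowerFubini              -- ★ p851247 (J) (LH7-p02 (g4)): `towerH_zero`, `towerH_eq_zero`, `towerH_succ`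
import Literature.NumberTheory.Automorphic.ArchRankOneCornerSocketsCayley      -- ★ p851235 (X3-rk1) (F0P3a-p04 (g24)): `cayley_nestedReader_hunif`, `cayley_nestedReader_hread`
import Literature.NumberTheory.Rogawski1990.ArchOrbFamGExtWallDescentDress     -- ★ p851164 (LH3-p02 (g4)): `coe_conj_cayleyTorus_eq_smul` (the centre of the torus arc as a scalar)
import Literature.NumberTheory.Rogawski1990.ArchOrbFamGExtFaceJetModel         -- ★ p851091 (LH3-p02 (g4)): §0 `exists_nhds_bddAbove_norm_iteratedFDeriv_mul_of_contDiffOn` (Leibniz, local factor)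
import Literature.NumberTheory.Automorphic.ArchCartanNormaliserSmoothOffSplitZero -- ★ `ArchCartan.isOpen_setOf_forall_mem_apply_ne_zero`
import Literature.NumberTheory.Rogawski1990.ArchOrbFamGExtTwoBlockBoxDescent     -- ★ p851307 (X2, m = 2) (LH3-p04 (g4)): `exists_descent_twoBlock_box_chartOrbG_pi` (ED. 2 consumer)
import Literature.NumberTheory.Rogawski1990.ArchOrbFamGExtSmoothInRegG         -- ★ (A5) p851150 (F0P3b-p01): `contDiffOn_orbFamGExt_inRegG` ((I₂) — ED. 2 consumer)
import HarnessLib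

/-!
# (I₁) AT A CROSS-PLACE CORNER — THE MODEL: given the `m`-block descent of `chartOrbG` at a corner with `(0,2)`-coincidences at the places `e : Fin m ↪ W`, every jet of
# `orbFamGExt` is bounded near the corner on `InRegG` (Harish-Chandra ∕ Varadarajan 1977 I §1.12; Bouaziz 1994 §3.1 (I₁)–(I₂); Shelstad 1979 §4; Rogawski 1990 §8.2)

Topic `NumberTheory/Rogawski1990`; namespace `Literature.NumberTheory.Rogawski1990`.  THEOREMS ONLY (no `def`, no instance, no notation, no axiom, no named fact, no `sorry`).  Cell
`pub/hodgecm-mathlib`, crux H413 (`stmt-HodgeConjecture-24833`), F0∕P3c line LH3 (closer stub `stub_N9`, DIRECT ROAD), LETTER L1 clause (I₁), organ **O-L1e `stub_N9hcCrossCornerJetBounds`**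
(X′-CORNERS) of leaf `F0_P3c_StubN9Direct` v5∕v6 (LH3-plan (g4) RULING #18; road of record 2026-09-02T11:13:39Z): **the ASSEMBLY, Layer A** — GIVEN the `m`-block descent identity of
`chartOrbG` at the corner ((X2), LH3-p04 (g4); here the hypotheses `K, U, f, hf, hfC, htan, hdesc`), the local jet bound follows from ★ (D) `exists_cornerBracket` (LH3-p02), ★ (J)
`towerH_*` (LH7-p02), ★ (X3-rk1) `cayley_nestedReader_hunif`∕`_hread` (F0P3a-p04), ★ (X3-asm) `contDiffOn_and_forall_bound_nestedReader` and ★ (X1) `…_of_multiWallModel` (this seat).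
Author F0P3a-p02 (g21) (binder of record).  Count-neutral.

THE MATHEMATICS.  Let `p` be a corner of the fundamental cube with `(0,2)`-coincidences at the compact, non-split places `e k` (`k : Fin m`): `p (e k) 0 = p (e k) 2`, the third eigenvalue
off (`e^{i p_{e k,1}} ≠ e^{i p_{e k,0}}`), every other compact place regular, the split places off their real walls.  (X2) says: on an open `U ∋ p`, for `G`-regular `c`,
`chartOrbG ν′ S a′ c = K · ∫_{U(J)^m} f (c, (Ad_{h_k}(P·diag(e^{ic_{e k,0}}, e^{ic_{e k,2}})·P⁻¹))_k) dμ₀^{⊗m}` with ONE jointly smooth `f`, compactly supported in the block variables,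
depending on `c` only off the `(0,2)`-slots of the corner places (`htan`).  Write `ψ_k(c) = (c_{e k,0} − c_{e k,2})∕2` (normal coordinates), `π c = c − Σ_k ψ_k(c)·hcNrm (e k) 0 2`
(tangential projection) and `z_k(c) = e^{i(c_{e k,0} + c_{e k,2})∕2}` (centres); then `diag(e^{ic₀}, e^{ic₂}) = z_k · diag(e^{iψ_k}, e^{−iψ_k})`, so (★ `coe_conj_cayleyTorus_eq_smul`) the
integrand is `f′ (π c, (Ad_{h_k}(P t₁(ψ_k) P⁻¹))_k)` with the CENTRED family `f′ (q, X) := f (q, (z_k(q) • X_k)_k)` (again jointly smooth, one compact support), i.e.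
`chartOrbG c = K · (Π_k 2 sin ψ_k)⁻¹ · H m f′ (π c, ψ(c))` with `H` the closed-form tower of ★ (J).  Near `p`, off the literal corner walls `c_{e k,0} ≠ c_{e k,2}`, the point is
`G`-regular (§1), so `orbFamGExt = R′ · chartOrbG` (★ `orbFamGExt_of_mem_regG_of_admissible`) and `e^{ρ} R′ = Br · Π_k 2 sin ψ_k` (★ (D)); hence
  `e^{ρ}_S(c) · orbFamGExt ν′ a′ S c = Br(c) · K · H m f′ (π c, ψ(c))` — the `hfac` of ★ (X1) `…_of_multiWallModel`.
The peeling theorem (★ (X3-asm), with `hunif`∕`hread` = ★ (X3-rk1) and the tower clauses = ★ (J)) makes `H m f′` smooth on `Q ×ˢ {sin ≠ 0}^m` with every jet bounded on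
`K₀ ×ˢ ({sin ≠ 0} ∩ [−½, ½])^m` (`Q` = split coordinates non-zero, `K₀` a compact ball around `p`); pulled back along the linear chart `c ↦ (π c, ψ(c))` and multiplied by the smooth
`Br · K` (Leibniz, ★ (B2) §0) this is the `hHs`∕`hHb` of ★ (X1), whence **`exists_nhds_bddAbove_norm_iteratedFDeriv_orbFamGExt_of_cornerDescent`**:
`∃ U′ ∈ 𝓝 p, BddAbove (‖Dⁿ(orbFamGExt ν′ a′ S)‖ '' (U′ ∩ InRegG (slotSign α) S))` for every `n`.  Layer B (the organ text: arbitrary X′ cube points, pairs `(0,1)`∕`(1,2)` moved to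
`(0,2)` by compact swaps, junk labels) and the discharge of the (X2) hypotheses are the next file.
HONEST LABEL: the descent identity is a HYPOTHESIS here (brick (X2), LH3-p04 (g4), in flight); HC_CM is proved only modulo the 7 printed citations (2 remaining: hLiu418 =
`stmt-HodgeConjecture-24832`, h413 = `stmt-HodgeConjecture-24833`) until rung 0 closes; this file moves no row of the books.

## References
* [Varadarajan1977] V. S. Varadarajan, *Harmonic Analysis on Real Reductive Groups*, LNM 576 (1977), Part I §1.12.
* [Bouaziz1994IntegralesOrbitales] A. Bouaziz, *Intégrales orbitales sur les groupes de Lie réductifs*, Ann. Sci. ÉNS 27 (1994), §3.1 (I₁)–(I₂) p. 579, §3.2 p. 580.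
* [Shelstad1979] D. Shelstad, *Characters and inner forms of a quasi-split group over ℝ*, Compositio Math. 39 (1979), §4 pp. 22–25.
* [Rogawski1990] J. D. Rogawski, *Automorphic Representations of Unitary Groups in Three Variables*, Ann. of Math. Stud. 123 (1990), §4.12 Lemma 4.12.1, §8.2 pp. 118–124.
-/

set_option autoImplicit false

noncomputable section

open Set Filter Topology Function MeasureTheory NumberField NumberField.InfinitePlace Complex
open scoped ContDiff MatrixGroups Matrix Classical Real Matrix.Norms.Operator

namespace Literature.NumberTheory.Rogawski1990

open Literature.NumberTheory.Automorphic Literature.NumberTheory.Automorphic.UnitaryGroup Literature.NumberTheory.Automorphic.ArchCartan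
open Literature.Analysis.Calculus

/-! ## §1 Corner geometry: near a `(0,2)`-corner, off the literal corner walls, the point is `G`-regular; the literal-wall data of ★ (X1) -/

section Geometry

variable {W : Type*} [Fintype W] [DecidableEq W]

omit [Fintype W] [DecidableEq W] in
/-- **THE CORNER NEIGHBOURHOOD**: at `p` with `p (e k) 0 = p (e k) 2` and the split places off their real walls, there is an open `U ∋ p` on which `|c_{e k,0} − c_{e k,2}| < π`
at every corner place and the split coordinates stay non-zero (so off the corner walls the normal coordinates `(c_{e k,0} − c_{e k,2})∕2` have `sin ≠ 0`).
[cite: Shelstad1979, §4 p. 22] [cite: Bouaziz1994IntegralesOrbitales, §3.2 p. 580] -/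
theorem exists_nhds_of_corners (S : Finset W) {m : ℕ} (e : Fin m ↪ W) {p : W → Fin 3 → ℝ} (hp02 : ∀ k, p (e k) 0 = p (e k) 2) (hsplit : ∀ w ∈ S, p w 0 ≠ 0) :
    ∃ U : Set (W → Fin 3 → ℝ), IsOpen U ∧ p ∈ U ∧ (∀ c ∈ U, ∀ k, |c (e k) 0 - c (e k) 2| < Real.pi) ∧ ∀ c ∈ U, ∀ w ∈ S, c w 0 ≠ 0 := by
  set U₁ : Set (W → Fin 3 → ℝ) := ⋂ k : Fin m, {c | |c (e k) 0 - c (e k) 2| < Real.pi} with hU₁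
  have hU₁o : IsOpen U₁ := by
    refine isOpen_iInter_of_finite fun k => ?_
    have hd : Continuous fun c : W → Fin 3 → ℝ => c (e k) 0 - c (e k) 2 := by fun_prop
    exact isOpen_lt (continuous_abs.comp hd) continuous_const
  have hp₁ : p ∈ U₁ := by
    simp only [hU₁, mem_iInter, mem_setOf_eq]
    intro k
    rw [hp02 k, sub_self, abs_zero]; exact Real.pi_pos
  refine ⟨U₁ ∩ {c | ∀ w ∈ S, c w 0 ≠ 0}, hU₁o.inter (ArchCartan.isOpen_setOf_forall_mem_apply_ne_zero S), ⟨hp₁, hsplit⟩, fun c hc k => ?_, fun c hc => hc.2⟩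
  have h := hc.1
  simp only [hU₁, mem_iInter, mem_setOf_eq] at h
  exact h k

/-- `sin ((a − b)∕2) ≠ 0` when `a ≠ b` and `|a − b| < π`. [cite: Rogawski1990, §8.2 p. 118] -/
theorem sin_half_sub_ne_zero {a b : ℝ} (hab : a ≠ b) (hlt : |a - b| < Real.pi) : Real.sin ((a - b) / 2) ≠ 0 := by
  intro h0
  rw [abs_lt] at hlt
  have h := (Real.sin_eq_zero_iff_of_lt_of_lt (by linarith) (by linarith)).1 h0
  exact hab (by linarith)

omit [Fintype W] in
/-- **The literal-wall data of ★ (X1) at a `(0,2)`-corner**: every coincident noncompact pair at `p` is a LITERAL coincidence (it is a `(0,2)`∕`(2,0)` pair at a corner place; no noncompact coincidence elsewhere, compact ones free).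
[cite: Shelstad1979, §4 p. 22] -/
theorem literal_of_corners (s : W → Fin 3 → SignType) (S : Finset W) {m : ℕ} (e : Fin m ↪ W) {p : W → Fin 3 → ℝ}
    (hp02 : ∀ k, p (e k) 0 = p (e k) 2) (hp1 : ∀ k, Circle.exp (p (e k) 1) ≠ Circle.exp (p (e k) 0))
    (hinreg : ∀ w, w ∉ S → w ∉ Set.range e → ∀ i j : Fin 3, i ≠ j → s w i ≠ s w j → Circle.exp (p w i) ≠ Circle.exp (p w j)) :
    ∀ w, w ∉ S → ∀ i j : Fin 3, i ≠ j → s w i ≠ s w j → Circle.exp (p w i) = Circle.exp (p w j) → p w i = p w j := by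
  intro w hw i j hij hs hco
  by_cases hwe : w ∈ Set.range e
  · obtain ⟨k, rfl⟩ := hwe
    have h02 : Circle.exp (p (e k) 0) = Circle.exp (p (e k) 2) := by rw [hp02 k]
    have h1 : Circle.exp (p (e k) 1) ≠ Circle.exp (p (e k) 0) := hp1 k
    have h1' : Circle.exp (p (e k) 1) ≠ Circle.exp (p (e k) 2) := by rw [← h02]; exact h1
    fin_cases i <;> fin_cases j
    · exact absurd rfl hij
    · exact absurd hco.symm h1
    · exact hp02 k
    · exact absurd hco h1
    · exact absurd rfl hij
    · exact absurd hco h1'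
    · exact (hp02 k).symm
    · exact absurd hco.symm h1'
    · exact absurd rfl hij
  · exact absurd hco (hinreg w hw hwe i j hij hs)

omit [Fintype W] [DecidableEq W] in
/-- **Off the literal walls = off the corner walls** at a `(0,2)`-corner: the `Ω_p`-clause of ★ (X1) gives `c (e k) 0 ≠ c (e k) 2` at every corner place (the pair `(0,2)` there is
noncompact, `hs02`). [cite: Shelstad1979, §4 p. 23] -/
theorem forall_corner_ne_of_offWalls (s : W → Fin 3 → SignType) (S : Finset W) {m : ℕ} (e : Fin m ↪ W) (he : ∀ k, e k ∉ S) (hs02 : ∀ k, s (e k) 0 ≠ s (e k) 2)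
    {p : W → Fin 3 → ℝ} (hp02 : ∀ k, p (e k) 0 = p (e k) 2) {c : W → Fin 3 → ℝ}
    (hc : ∀ w, w ∉ S → ∀ i j : Fin 3, i ≠ j → s w i ≠ s w j → p w i = p w j → c w i ≠ c w j) : ∀ k, c (e k) 0 ≠ c (e k) 2 :=
  fun k => hc (e k) (he k) 0 2 (by decide) (hs02 k) (hp02 k)

end Geometry

/-! ## §2 The corner chart: normal coordinates `ψ_k`, tangential projection `π`, centres `z_k` -/

section Chart

variable {W : Type*} [Fintype W] [DecidableEq W]

omit [Fintype W] in
/-- `hcNrm w 0 2` in coordinates: `1` at `(w,0)`, `−1` at `(w,2)`, `0` elsewhere. [cite: Shelstad1979, Lemma 4.3 (p. 25)] -/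
theorem hcNrm_zero_two_apply (w w' : W) (l : Fin 3) :
    hcNrm w (0 : Fin 3) 2 w' l = if w' = w then (if l = 0 then 1 else if l = 2 then -1 else 0) else 0 := by
  unfold hcNrm
  by_cases hw : w' = w
  · subst hw
    fin_cases l <;> simp
  · simp [hw]

omit [Fintype W] in
/-- **THE CORNER CHART IS A CONTINUOUS LINEAR MAP** `c ↦ (π c, ψ(c))` with `ψ_k(c) = (c_{e k,0} − c_{e k,2})∕2`, `π c = c − Σ_k ψ_k(c) • hcNrm (e k) 0 2`; its values in coordinates.
[cite: Shelstad1979, Lemma 4.3 (p. 25)] -/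
theorem exists_cornerChart {m : ℕ} (e : Fin m ↪ W) :
    ∃ A : (W → Fin 3 → ℝ) →L[ℝ] (W → Fin 3 → ℝ) × (Fin m → ℝ), ∀ c,
      A c = (c - ∑ k, ((c (e k) 0 - c (e k) 2) / 2) • hcNrm (e k) 0 2, fun k => (c (e k) 0 - c (e k) 2) / 2) := by
  -- the normal coordinates as CLMs
  let ψ : Fin m → (W → Fin 3 → ℝ) →L[ℝ] ℝ := fun k => (1 / 2 : ℝ) •
    ((ContinuousLinearMap.proj (R := ℝ) (φ := fun _ : Fin 3 => ℝ) (0 : Fin 3)).comp (ContinuousLinearMap.proj (R := ℝ) (φ := fun _ : W => Fin 3 → ℝ) (e k)) -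
      (ContinuousLinearMap.proj (R := ℝ) (φ := fun _ : Fin 3 => ℝ) (2 : Fin 3)).comp (ContinuousLinearMap.proj (R := ℝ) (φ := fun _ : W => Fin 3 → ℝ) (e k)))
  have hψ : ∀ k c, ψ k c = (c (e k) 0 - c (e k) 2) / 2 := fun k c => by
    change (1 / 2 : ℝ) • (c (e k) 0 - c (e k) 2) = _
    rw [smul_eq_mul]
    ring
  refine ⟨(ContinuousLinearMap.id ℝ _ - ∑ k, (ψ k).smulRight (hcNrm (e k) (0 : Fin 3) 2)).prod (ContinuousLinearMap.pi ψ), fun c => ?_⟩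
  refine Prod.ext ?_ (funext fun k => ?_)
  · simp [ContinuousLinearMap.smulRight_apply, hψ]
  · simp only [ContinuousLinearMap.prod_apply, ContinuousLinearMap.pi_apply, hψ]

omit [Fintype W] in
/-- **Coordinates of the tangential projection**: off the corner places `π c = c`; at a corner place the slot `1` is unchanged and the slots `0`, `2` both become the mean.
[cite: Shelstad1979, Lemma 4.3 (p. 25)] -/
theorem cornerProj_apply {m : ℕ} (e : Fin m ↪ W) (c : W → Fin 3 → ℝ) :
    (∀ w, w ∉ Set.range e → (c - ∑ k, ((c (e k) 0 - c (e k) 2) / 2) • hcNrm (e k) (0 : Fin 3) 2) w = c w) ∧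
    (∀ k, (c - ∑ k, ((c (e k) 0 - c (e k) 2) / 2) • hcNrm (e k) (0 : Fin 3) 2) (e k) 1 = c (e k) 1) ∧
    (∀ k, (c - ∑ k, ((c (e k) 0 - c (e k) 2) / 2) • hcNrm (e k) (0 : Fin 3) 2) (e k) 0 = (c (e k) 0 + c (e k) 2) / 2) ∧
    (∀ k, (c - ∑ k, ((c (e k) 0 - c (e k) 2) / 2) • hcNrm (e k) (0 : Fin 3) 2) (e k) 2 = (c (e k) 0 + c (e k) 2) / 2) := by
  have hsum : ∀ (w : W) (l : Fin 3), (∑ k, ((c (e k) 0 - c (e k) 2) / 2) • hcNrm (e k) (0 : Fin 3) 2) w l =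
      ∑ k, ((c (e k) 0 - c (e k) 2) / 2) * hcNrm (e k) (0 : Fin 3) 2 w l := by
    intro w l
    simp only [Finset.sum_apply, Pi.smul_apply, smul_eq_mul]
  refine ⟨fun w hw => ?_, fun k => ?_, fun k => ?_, fun k => ?_⟩
  · funext l
    rw [Pi.sub_apply, Pi.sub_apply, hsum]
    have h0 : ∑ k, (c (e k) 0 - c (e k) 2) / 2 * hcNrm (e k) (0 : Fin 3) 2 w l = 0 := by
      refine Finset.sum_eq_zero fun k _ => ?_
      have hne : w ≠ e k := fun h => hw ⟨k, h.symm⟩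
      rw [hcNrm_zero_two_apply, if_neg hne, mul_zero]
    rw [h0, sub_zero]
  all_goals
    rw [Pi.sub_apply, Pi.sub_apply, hsum, Finset.sum_eq_single k (fun k' _ hk' => by
      rw [hcNrm_zero_two_apply, if_neg (fun h => hk' (e.injective h).symm), mul_zero]) (fun h => (h (Finset.mem_univ k)).elim),
      hcNrm_zero_two_apply, if_pos rfl]
    simp
    try ring

end Chart

/-! ## §3 THE MODEL: local jet bounds of `orbFamGExt` at a `(0,2)`-corner from the `m`-block descent identity -/

section Model

variable (L : Type) [Field L] [NumberField L] [IsCMField L] (α : Fin 3 → L)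
  [MeasurableSpace ↥(arch (↥(maximalRealSubfield L)) L (IsCMField.complexConj L) 3 (Matrix.diagonal α))]
  [BorelSpace ↥(arch (↥(maximalRealSubfield L)) L (IsCMField.complexConj L) 3 (Matrix.diagonal α))]
  (ν' : Measure ↥(arch (↥(maximalRealSubfield L)) L (IsCMField.complexConj L) 3 (Matrix.diagonal α))) [ν'.IsHaarMeasure] [ν'.IsMulRightInvariant]

/-- **(I₁) AT A MULTI-WALL POINT FROM A MODEL ON THE `G`-REGULAR SET ONLY, WITH THE DENSITY UPGRADE.**  As ★ (X1) `exists_nhds_bddAbove_norm_iteratedFDeriv_orbFamGExt_of_multiWallModel`,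
but the identity `e^{ρ}·orbFamGExt = H` is asked only at the `G`-REGULAR points of `U` (where `orbFamGExt = R′·chartOrbG` literally; on the compact walls inside `InRegG` the family is
a continuous extension and no descent identity is claimed), the model `H` being `Cⁿ` with locally bounded jets off the literal noncompact walls as before.  The bound obtained on
`U′ ∩ RegG S′` UPGRADES to `U′ ∩ InRegG (slotSign α) S′` because `RegG S′` is dense (★ `dense_regG`, LH7-p02 (g2)) and the jets of `orbFamGExt` are CONTINUOUS on the open `InRegG`
(hypothesis `h1` = clause (I₂), ★ O-L1a `contDiffOn_orbFamGExt_inRegG`).  This is what lets the corner assembly ignore compact coincidences at the non-corner places.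
[cite: Varadarajan1977, Part I §1.12] [cite: Bouaziz1994IntegralesOrbitales, §3.1 (I₁)–(I₂) p. 579; §6.2 p. 591] [cite: Shelstad1979, §4 pp. 22–24] -/
theorem exists_nhds_bddAbove_norm_iteratedFDeriv_orbFamGExt_of_regGModel (a' : ↥(arch (↥(maximalRealSubfield L)) L (IsCMField.complexConj L) 3 (Matrix.diagonal α)) → ℂ)
    (S' : Finset {w : InfinitePlace L // IsComplex w}) (h1 : ContDiffOn ℝ ∞ (orbFamGExt L α ν' a' S') (InRegG (slotSign L α) S'))
    {x : {w : InfinitePlace L // IsComplex w} → Fin 3 → ℝ}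
    (hlit : ∀ w, w ∉ S' → ∀ i j : Fin 3, i ≠ j → slotSign L α w i ≠ slotSign L α w j → Circle.exp (x w i) = Circle.exp (x w j) → x w i = x w j)
    {U : Set ({w : InfinitePlace L // IsComplex w} → Fin 3 → ℝ)} (hU : U ∈ 𝓝 x) (H : ({w : InfinitePlace L // IsComplex w} → Fin 3 → ℝ) → ℂ)
    (hfac : ∀ c ∈ U, c ∈ RegG S' → archERhoG S' c * orbFamGExt L α ν' a' S' c = H c)
    (n : ℕ) (hHs : ContDiffOn ℝ n H (U ∩ {c | ∀ w, w ∉ S' → ∀ i j : Fin 3, i ≠ j → slotSign L α w i ≠ slotSign L α w j → x w i = x w j → c w i ≠ c w j}))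
    (hHb : ∀ k ≤ n, ∃ U' ∈ 𝓝 x, BddAbove ((fun c => ‖iteratedFDeriv ℝ k H c‖) ''
      (U' ∩ {c | ∀ w, w ∉ S' → ∀ i j : Fin 3, i ≠ j → slotSign L α w i ≠ slotSign L α w j → x w i = x w j → c w i ≠ c w j}))) :
    ∃ U' ∈ 𝓝 x, BddAbove ((fun c => ‖iteratedFDeriv ℝ n (orbFamGExt L α ν' a' S') c‖) '' (U' ∩ InRegG (slotSign L α) S')) := by
  obtain ⟨U₀, hU₀o, hxU₀, hU₀⟩ := exists_nhds_forall_mem_inRegG_iff_of_multiWall (slotSign L α) S' hlit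
  set Ω : Set ({w : InfinitePlace L // IsComplex w} → Fin 3 → ℝ) :=
    {c | ∀ w, w ∉ S' → ∀ i j : Fin 3, i ≠ j → slotSign L α w i ≠ slotSign L α w j → x w i = x w j → c w i ≠ c w j} with hΩ
  have hΩo : IsOpen Ω := isOpen_setOf_forall_multiWall_ne (slotSign L α) S' x
  set O : Set ({w : InfinitePlace L // IsComplex w} → Fin 3 → ℝ) := interior U ∩ U₀ ∩ Ω with hO
  have hOo : IsOpen O := (isOpen_interior.inter hU₀o).inter hΩo
  have hOsub : O ⊆ U ∩ Ω := fun c hc => ⟨interior_subset hc.1.1, hc.2⟩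
  -- Leibniz with the smooth unit `(e^ρ)⁻¹`
  have hf : ContDiff ℝ ∞ fun c : {w : InfinitePlace L // IsComplex w} → Fin 3 → ℝ => (archERhoG S' c)⁻¹ :=
    (contDiff_archERhoG S').inv fun c => archERhoG_ne_zero_of_fintype S' c
  have hb : ∀ k ≤ n, ∃ U' ∈ 𝓝 x, BddAbove ((fun c => ‖iteratedFDeriv ℝ k H c‖) '' (U' ∩ O)) := by
    intro k hk
    obtain ⟨U', hU', hB⟩ := hHb k hk
    exact ⟨U', hU', hB.mono (image_mono fun c hc => show c ∈ U' ∩ Ω from ⟨hc.1, hc.2.2⟩)⟩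
  obtain ⟨U₁, hU₁, B, hB⟩ := Literature.Analysis.Calculus.exists_nhds_bddAbove_norm_iteratedFDeriv_mul hf hOo (hHs.mono hOsub) hb
  -- the `G`-regular part of a small open neighbourhood
  set U₂ : Set ({w : InfinitePlace L // IsComplex w} → Fin 3 → ℝ) := interior U₁ ∩ (interior U ∩ U₀) with hU₂
  have hU₂o : IsOpen U₂ := isOpen_interior.inter (isOpen_interior.inter hU₀o)
  have hxU₂ : x ∈ U₂ := ⟨mem_interior_iff_mem_nhds.2 hU₁, mem_interior_iff_mem_nhds.2 hU, hxU₀⟩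
  have hregΩ : ∀ c, c ∈ RegG S' → c ∈ Ω := fun c hc w hw i j hij _ _ heq => hij (hc.1 w hw (by simp only [heq]))
  have hEq : ∀ c ∈ O ∩ RegG S', orbFamGExt L α ν' a' S' c = (archERhoG S' c)⁻¹ * H c := by
    intro c hc
    rw [← hfac c (hOsub hc.1).1 hc.2, ← mul_assoc, inv_mul_cancel₀ (archERhoG_ne_zero_of_fintype S' c), one_mul]
  have hreg_bd : ∀ c ∈ U₂ ∩ RegG S', ‖iteratedFDeriv ℝ n (orbFamGExt L α ν' a' S') c‖ ≤ B := by
    rintro c ⟨⟨hc₁, hcU, hcU₀⟩, hcreg⟩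
    have hcO : c ∈ O := ⟨⟨hcU, hcU₀⟩, hregΩ c hcreg⟩
    have hev : (fun c => (archERhoG S' c)⁻¹ * H c) =ᶠ[𝓝 c] orbFamGExt L α ν' a' S' :=
      Filter.eventuallyEq_of_mem ((hOo.inter (isOpen_regG S')).mem_nhds ⟨hcO, hcreg⟩) fun y hy => (hEq y hy).symm
    rw [← (hev.iteratedFDeriv ℝ n).eq_of_nhds]
    exact hB ⟨c, ⟨interior_subset hc₁, hcO⟩, rfl⟩
  -- density upgrade: the jets are continuous on the open `InRegG`, and `RegG` is dense
  refine ⟨U₂, hU₂o.mem_nhds hxU₂, B, ?_⟩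
  rintro _ ⟨c, ⟨hcU₂, hcin⟩, rfl⟩
  have hcont : ContinuousOn (fun c => ‖iteratedFDeriv ℝ n (orbFamGExt L α ν' a' S') c‖) (InRegG (slotSign L α) S') :=
    ((h1.continuousOn_iteratedFDerivWithin (m := n) (mod_cast le_top) (isOpen_inRegG (slotSign L α) S').uniqueDiffOn).congr
      fun y hy => (iteratedFDerivWithin_of_isOpen n (isOpen_inRegG (slotSign L α) S') hy).symm).norm
  have hcl : c ∈ closure (U₂ ∩ RegG S') := (dense_regG S').open_subset_closure_inter hU₂o hcU₂
  haveI : (𝓝[U₂ ∩ RegG S'] c).NeBot := mem_closure_iff_nhdsWithin_neBot.1 hcl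
  have htend : Tendsto (fun c => ‖iteratedFDeriv ℝ n (orbFamGExt L α ν' a' S') c‖) (𝓝[U₂ ∩ RegG S'] c)
      (𝓝 ‖iteratedFDeriv ℝ n (orbFamGExt L α ν' a' S') c‖) :=
    (hcont c hcin).tendsto.mono_left (nhdsWithin_mono c fun y hy => regG_subset_inRegG (slotSign L α) S' hy.2)
  exact le_of_tendsto htend (eventually_nhdsWithin_of_forall fun y hy => hreg_bd y hy)

/-- **(I₁) AT A `(0,2)`-CORNER FROM THE `m`-BLOCK DESCENT (Layer A of organ O-L1e).**  `J` the antidiagonal `2 × 2` form with a two-sided Haar `μ₀` on `U(J)`;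
`S` admissible; corner places `e : Fin m ↪ W` off `S` with `(0,2)` noncompact there (`hs02`); base point `p` with `p (e k) 0 = p (e k) 2`, third eigenvalue off, NO NONCOMPACT coincidence at the other compact
places (compact coincidences allowed — `hinreg`), split coordinates non-zero; clause (I₂) for the chart family (`h1`, ★ O-L1a).  HYPOTHESES = the output of the `m`-block descent box (X2) at `p`: a constant `K`, an open `U ∋ p`, ONE jointly smooth
`f : (coords) × (Fin m → M₂(ℂ)) → ℂ` vanishing as soon as one block variable leaves a compact `C`, TANGENTIAL (`htan`: `f (c, X)` depends on `c` only off the `(0,2)`-slots of the corner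
places), and the identity `chartOrbG ν′ S a′ c = K · ∫_{U(J)^m} f (c, (Ad_{h_k}(P·diag(e^{ic_{e k,0}}, e^{ic_{e k,2}})·P⁻¹))_k) dμ₀^{⊗m}` for `c ∈ U ∩ RegG S` (`hdesc`).  CONCLUSION: for every `n`,
`∃ U′ ∈ 𝓝 p, BddAbove (‖Dⁿ(orbFamGExt ν′ a′ S)‖ '' (U′ ∩ InRegG (slotSign α) S))`.  Proof: at the `G`-REGULAR points near `p`, ★ `orbFamGExt_of_mem_regG_of_admissible` + ★ (D)
`exists_cornerBracket` + the centring `diag(e^{ic₀}, e^{ic₂}) = z_k · t₁(ψ_k)` (★ `coe_conj_cayleyTorus_eq_smul`) give `e^{ρ}·orbFamGExt = Br · K · H m f′ ∘ (π, ψ)` off the walls near `p`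
(`H` = ★ (J) tower, `f′` the centred family); ★ (X3-asm) `contDiffOn_and_forall_bound_nestedReader` (sockets ★ (X3-rk1), ★ (J)) bounds the jets of `H m f′` on `K₀ ×ˢ ({sin ≠ 0} ∩ [−½,½])^m`;
pull back along the linear chart (★ (B2) §1), Leibniz with `Br · K` (★ (B2) §0), §3 `…_of_regGModel` (★ (X1) + the density upgrade, ★ `dense_regG`).
[cite: Varadarajan1977, Part I §1.12] [cite: Bouaziz1994IntegralesOrbitales, §3.1 (I₁)–(I₂) p. 579; §3.2 p. 580] [cite: Shelstad1979, §4 pp. 22–25] [cite: Rogawski1990, §8.2 pp. 118–124] -/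
theorem exists_nhds_bddAbove_norm_iteratedFDeriv_orbFamGExt_of_cornerDescent
    {J : Matrix (Fin 2) (Fin 2) ℂ} (hJ : J = (StdForm.antidiagonal 2).over ℂ)
    [MeasurableSpace ↥(unitaryGroupOfForm (starRingEnd ℂ) J)] [BorelSpace ↥(unitaryGroupOfForm (starRingEnd ℂ) J)]
    [LocallyCompactSpace ↥(unitaryGroupOfForm (starRingEnd ℂ) J)] [SecondCountableTopology ↥(unitaryGroupOfForm (starRingEnd ℂ) J)]
    (μ₀ : Measure ↥(unitaryGroupOfForm (starRingEnd ℂ) J)) [μ₀.IsHaarMeasure] [μ₀.IsMulRightInvariant]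
    {S : Finset {w : InfinitePlace L // IsComplex w}} (hS : ∀ w, w ∈ S → w ∈ splitChartPlaces L α)
    {m : ℕ} (e : Fin m ↪ {w : InfinitePlace L // IsComplex w}) (he : ∀ k, e k ∉ S) (hs02 : ∀ k, slotSign L α (e k) 0 ≠ slotSign L α (e k) 2)
    {p : {w : InfinitePlace L // IsComplex w} → Fin 3 → ℝ} (hp02 : ∀ k, p (e k) 0 = p (e k) 2) (hp1 : ∀ k, Circle.exp (p (e k) 1) ≠ Circle.exp (p (e k) 0))
    (hinreg : ∀ w, w ∉ S → w ∉ Set.range e → ∀ i j : Fin 3, i ≠ j → slotSign L α w i ≠ slotSign L α w j → Circle.exp (p w i) ≠ Circle.exp (p w j))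
    (hsplit : ∀ w ∈ S, p w 0 ≠ 0)
    {a' : ↥(arch (↥(maximalRealSubfield L)) L (IsCMField.complexConj L) 3 (Matrix.diagonal α)) → ℂ} (h1 : ContDiffOn ℝ ∞ (orbFamGExt L α ν' a' S) (InRegG (slotSign L α) S))
    -- the (X2) output
    (K : ℂ) {U : Set ({w : InfinitePlace L // IsComplex w} → Fin 3 → ℝ)} (hUo : IsOpen U) (hpU : p ∈ U)
    (f : ({w : InfinitePlace L // IsComplex w} → Fin 3 → ℝ) × (Fin m → Matrix (Fin 2) (Fin 2) ℂ) → ℂ) (hf : ContDiff ℝ ∞ f)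
    {C : Set (Matrix (Fin 2) (Fin 2) ℂ)} (hC : IsCompact C) (hfC : ∀ c X, (∃ k, X k ∉ C) → f (c, X) = 0)
    (htan : ∀ c c' X, (∀ w, w ∉ Set.range e → c w = c' w) → (∀ k, c (e k) 1 = c' (e k) 1) → f (c, X) = f (c', X))
    (hdesc : ∀ c ∈ U, c ∈ RegG S → chartOrbG L α ν' S a' c = K * ∫ h : Fin m → ↥(unitaryGroupOfForm (starRingEnd ℂ) J),
      f (c, fun k => (((h k * ⟨Matrix.GeneralLinearGroup.mkOfDetNeZero !![(1 : ℂ), 1; 1, -1] det_cayleyTwo_ne_zero *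
            circleDiagonal 2 ![Circle.exp (c (e k) 0), Circle.exp (c (e k) 2)] *
            (Matrix.GeneralLinearGroup.mkOfDetNeZero !![(1 : ℂ), 1; 1, -1] det_cayleyTwo_ne_zero)⁻¹, cayley_conj_circleDiagonal_mem_of_eq_over hJ _⟩ * (h k)⁻¹ :
          ↥(unitaryGroupOfForm (starRingEnd ℂ) J)) : GL (Fin 2) ℂ) : Matrix (Fin 2) (Fin 2) ℂ)) ∂(Measure.pi fun _ : Fin m => μ₀))
    (n : ℕ) :
    ∃ U' ∈ 𝓝 p, BddAbove ((fun c => ‖iteratedFDeriv ℝ n (orbFamGExt L α ν' a' S) c‖) '' (U' ∩ InRegG (slotSign L α) S)) := by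
  -- NOTATION: coordinates, block space, the Cayley conjugation at centre `1`
  -- the Cayley functional at centre `1` (★ p851143's `hF` text with `z = 1`) and its sockets
  obtain ⟨F, hF⟩ : ∃ F : (Matrix (Fin 2) (Fin 2) ℂ → ℂ) → ℝ → ℂ, ∀ (g : Matrix (Fin 2) (Fin 2) ℂ → ℂ) (ψ : ℝ), F g ψ = (2 * Real.sin ψ) •
      ∫ h : ↥(unitaryGroupOfForm (starRingEnd ℂ) J), g (((h * ⟨Matrix.GeneralLinearGroup.mkOfDetNeZero !![(1 : ℂ), 1; 1, -1] det_cayleyTwo_ne_zero *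
            circleDiagonal 2 ![1 * Circle.exp ψ, 1 * Circle.exp (-ψ)] * (Matrix.GeneralLinearGroup.mkOfDetNeZero !![(1 : ℂ), 1; 1, -1] det_cayleyTwo_ne_zero)⁻¹,
          cayley_conj_circleDiagonal_mem_of_eq_over hJ _⟩ * h⁻¹ : ↥(unitaryGroupOfForm (starRingEnd ℂ) J)) : GL (Fin 2) ℂ) : Matrix (Fin 2) (Fin 2) ℂ) ∂μ₀ :=
    ⟨fun g ψ => _, fun _ _ => rfl⟩
  have hF' : ∀ (g : Matrix (Fin 2) (Fin 2) ℂ → ℂ) (ψ : ℝ), F g ψ = (2 * Real.sin ψ) •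
      ∫ h : ↥(unitaryGroupOfForm (starRingEnd ℂ) J), g (((h * ⟨Matrix.GeneralLinearGroup.mkOfDetNeZero !![(1 : ℂ), 1; 1, -1] det_cayleyTwo_ne_zero *
            circleDiagonal 2 ![Circle.exp ψ, Circle.exp (-ψ)] * (Matrix.GeneralLinearGroup.mkOfDetNeZero !![(1 : ℂ), 1; 1, -1] det_cayleyTwo_ne_zero)⁻¹,
          cayley_conj_circleDiagonal_mem_of_eq_over hJ _⟩ * h⁻¹ : ↥(unitaryGroupOfForm (starRingEnd ℂ) J)) : GL (Fin 2) ℂ) : Matrix (Fin 2) (Fin 2) ℂ) ∂μ₀ := by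
    intro g ψ
    rw [hF]
    simp only [one_mul]
  have hunif := cayley_nestedReader_hunif (E := ℂ) hJ μ₀ 1 F hF (T₀ := Icc (-(1 / 2 : ℝ)) (1 / 2)) Subset.rfl
  have hread := cayley_nestedReader_hread (E := ℂ) hJ μ₀ 1 F hF
  have hT : IsOpen {ψ : ℝ | Real.sin ψ ≠ 0} := isOpen_ne_fun Real.continuous_sin continuous_const
  -- the corner bracket (★ (D))
  obtain ⟨Br, hBrs, hBr0, hBr⟩ := exists_cornerBracket S e he
  -- the centred family `f′`
  set f' : ({w : InfinitePlace L // IsComplex w} → Fin 3 → ℝ) × (Fin m → Matrix (Fin 2) (Fin 2) ℂ) → ℂ :=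
    fun z => f (z.1, fun k => ((Circle.exp ((z.1 (e k) 0 + z.1 (e k) 2) / 2) : Circle) : ℂ) • z.2 k) with hf'def
  have hθ : ∀ k : Fin m, ContDiff ℝ ∞ fun q : {w : InfinitePlace L // IsComplex w} → Fin 3 → ℝ => ((Circle.exp ((q (e k) 0 + q (e k) 2) / 2) : Circle) : ℂ) := fun k =>
    contDiff_coe_circleExp_comp_of_contDiff (((contDiff_apply_apply ℝ ℝ (e k) 0).add (contDiff_apply_apply ℝ ℝ (e k) 2)).div_const _)
  have hf's : ContDiff ℝ ∞ f' := by
    refine hf.comp (contDiff_fst.prodMk (contDiff_pi.2 fun k => ((hθ k).comp contDiff_fst).smul ?_))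
    exact (contDiff_apply ℝ (Matrix (Fin 2) (Fin 2) ℂ) k).comp contDiff_snd
  obtain ⟨R, hR⟩ := hC.isBounded.subset_closedBall (0 : Matrix (Fin 2) (Fin 2) ℂ)
  have hf'C : ∀ (q : {w : InfinitePlace L // IsComplex w} → Fin 3 → ℝ) (X : Fin m → Matrix (Fin 2) (Fin 2) ℂ),
      (∃ k, X k ∉ Metric.closedBall (0 : Matrix (Fin 2) (Fin 2) ℂ) R) → f' (q, X) = 0 := by
    rintro q X ⟨k, hk⟩
    refine hfC q _ ⟨k, fun hmem => hk ?_⟩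
    have h := hR hmem
    rw [Metric.mem_closedBall, dist_zero_right, norm_smul, Circle.norm_coe, one_mul] at h
    rwa [Metric.mem_closedBall, dist_zero_right]
  -- the peeling theorem for `f′` on `Q := {split coordinates non-zero}`, compact ball `K₀` around `p`
  set Q : Set ({w : InfinitePlace L // IsComplex w} → Fin 3 → ℝ) := {q | ∀ w ∈ S, q w 0 ≠ 0} with hQdef
  have hQo : IsOpen Q := ArchCartan.isOpen_setOf_forall_mem_apply_ne_zero S
  have hpQ : p ∈ Q := hsplit
  obtain ⟨r, hr, hrQ⟩ := Metric.nhds_basis_closedBall.mem_iff.1 (hQo.mem_nhds hpQ)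
  obtain ⟨hsm, hbd⟩ := contDiffOn_and_forall_bound_nestedReader F hT (Icc (-(1 / 2 : ℝ)) (1 / 2)) hunif hread
    (fun m P' f z => (∏ k, 2 * Real.sin (z.2 k)) • ∫ h : Fin m → ↥(unitaryGroupOfForm (starRingEnd ℂ) J),
      f (z.1, fun k => (((h k * ⟨Matrix.GeneralLinearGroup.mkOfDetNeZero !![(1 : ℂ), 1; 1, -1] det_cayleyTwo_ne_zero *
            circleDiagonal 2 ![Circle.exp (z.2 k), Circle.exp (-(z.2 k))] *
            (Matrix.GeneralLinearGroup.mkOfDetNeZero !![(1 : ℂ), 1; 1, -1] det_cayleyTwo_ne_zero)⁻¹, cayley_conj_circleDiagonal_mem_of_eq_over hJ _⟩ * (h k)⁻¹ :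
          ↥(unitaryGroupOfForm (starRingEnd ℂ) J)) : GL (Fin 2) ℂ) : Matrix (Fin 2) (Fin 2) ℂ)) ∂(Measure.pi fun _ => μ₀))
    (fun P' f q ψ => towerH_zero hJ μ₀ P' f q ψ)
    (fun m P' _ _ Q hQ f hf hC q hq ψ hψ => towerH_succ hJ μ₀ F hF' m P' Q hQ f hf hC q hq ψ hψ)
    (fun m P' f q ψ h0 => towerH_eq_zero hJ μ₀ m P' f q ψ h0)
    m ({w : InfinitePlace L // IsComplex w} → Fin 3 → ℝ) Q hQo f' hf's.contDiffOn (Metric.closedBall 0 R) (isCompact_closedBall 0 R) hf'C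
    (Metric.closedBall p r) (isCompact_closedBall p r) hrQ
  -- abbreviate the tower of `f′`
  set Hm : ({w : InfinitePlace L // IsComplex w} → Fin 3 → ℝ) × (Fin m → ℝ) → ℂ := fun z => (∏ k, 2 * Real.sin (z.2 k)) •
      ∫ h : Fin m → ↥(unitaryGroupOfForm (starRingEnd ℂ) J), f' (z.1, fun k => (((h k * ⟨Matrix.GeneralLinearGroup.mkOfDetNeZero !![(1 : ℂ), 1; 1, -1] det_cayleyTwo_ne_zero *
            circleDiagonal 2 ![Circle.exp (z.2 k), Circle.exp (-(z.2 k))] *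
            (Matrix.GeneralLinearGroup.mkOfDetNeZero !![(1 : ℂ), 1; 1, -1] det_cayleyTwo_ne_zero)⁻¹, cayley_conj_circleDiagonal_mem_of_eq_over hJ _⟩ * (h k)⁻¹ :
          ↥(unitaryGroupOfForm (starRingEnd ℂ) J)) : GL (Fin 2) ℂ) : Matrix (Fin 2) (Fin 2) ℂ)) ∂(Measure.pi fun _ => μ₀) with hHmdef
  -- the corner chart
  obtain ⟨A, hA⟩ := exists_cornerChart (W := {w : InfinitePlace L // IsComplex w}) e
  have hA1 : ∀ c, (A c).1 = c - ∑ k, ((c (e k) 0 - c (e k) 2) / 2) • hcNrm (e k) 0 2 := fun c => by rw [hA]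
  have hA2 : ∀ c, (A c).2 = fun k => (c (e k) 0 - c (e k) 2) / 2 := fun c => by rw [hA]
  have hAp : A p = (p, (0 : Fin m → ℝ)) := by
    rw [hA]
    refine Prod.ext ?_ (funext fun k => ?_)
    · simp only [hp02, sub_self, zero_div, zero_smul, Finset.sum_const_zero, sub_zero]
    · simp only [hp02, sub_self, zero_div, Pi.zero_apply]
  obtain ⟨hπoff, hπ1, hπ0, hπ2⟩ : (∀ (c : {w : InfinitePlace L // IsComplex w} → Fin 3 → ℝ) (w : {w : InfinitePlace L // IsComplex w}), w ∉ Set.range e → (A c).1 w = c w) ∧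
      (∀ (c : {w : InfinitePlace L // IsComplex w} → Fin 3 → ℝ) (k : Fin m), (A c).1 (e k) 1 = c (e k) 1) ∧
      (∀ (c : {w : InfinitePlace L // IsComplex w} → Fin 3 → ℝ) (k : Fin m), (A c).1 (e k) 0 = (c (e k) 0 + c (e k) 2) / 2) ∧
      (∀ (c : {w : InfinitePlace L // IsComplex w} → Fin 3 → ℝ) (k : Fin m), (A c).1 (e k) 2 = (c (e k) 0 + c (e k) 2) / 2) := by
    refine ⟨fun c w hw => ?_, fun c k => ?_, fun c k => ?_, fun c k => ?_⟩ <;> rw [hA1]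
    · exact (cornerProj_apply e c).1 w hw
    · exact (cornerProj_apply e c).2.1 k
    · exact (cornerProj_apply e c).2.2.1 k
    · exact (cornerProj_apply e c).2.2.2 k
  -- §1 geometry at the corner
  obtain ⟨U₀, hU₀o, hpU₀, hU₀π, hU₀S⟩ := exists_nhds_of_corners S e hp02 hsplit
  have hlit := literal_of_corners (slotSign L α) S e hp02 hp1 hinreg
  -- the open region where the tower is smooth, and the facts «off the corner walls near p»
  set O : Set ({w : InfinitePlace L // IsComplex w} → Fin 3 → ℝ) := A ⁻¹' (Q ×ˢ Set.pi univ fun _ : Fin m => {ψ : ℝ | Real.sin ψ ≠ 0}) with hOdef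
  have hQT : IsOpen (Q ×ˢ Set.pi univ fun _ : Fin m => {ψ : ℝ | Real.sin ψ ≠ 0}) := hQo.prod (isOpen_set_pi finite_univ fun _ _ => hT)
  have hOo : IsOpen O := hQT.preimage A.continuous
  have hoff : ∀ c ∈ U ∩ U₀, (∀ w, w ∉ S → ∀ i j : Fin 3, i ≠ j → slotSign L α w i ≠ slotSign L α w j → p w i = p w j → c w i ≠ c w j) →
      (∀ k, c (e k) 0 ≠ c (e k) 2) ∧ (∀ k, Real.sin ((c (e k) 0 - c (e k) 2) / 2) ≠ 0) ∧ c ∈ O := by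
    intro c hc hΩ
    have hne : ∀ k, c (e k) 0 ≠ c (e k) 2 := forall_corner_ne_of_offWalls (slotSign L α) S e he hs02 hp02 hΩ
    have hsin : ∀ k, Real.sin ((c (e k) 0 - c (e k) 2) / 2) ≠ 0 := fun k => sin_half_sub_ne_zero (hne k) (hU₀π c hc.2 k)
    refine ⟨hne, hsin, ?_⟩
    show A c ∈ Q ×ˢ Set.pi univ fun _ : Fin m => {ψ : ℝ | Real.sin ψ ≠ 0}
    refine ⟨fun w hw => ?_, fun k _ => ?_⟩
    · rw [hπoff c w (fun ⟨k, hk⟩ => he k (hk ▸ hw))]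
      exact hU₀S c hc.2 w hw
    · rw [hA2]; exact hsin k
  have hregΩ : ∀ c : {w : InfinitePlace L // IsComplex w} → Fin 3 → ℝ, c ∈ RegG S →
      ∀ w, w ∉ S → ∀ i j : Fin 3, i ≠ j → slotSign L α w i ≠ slotSign L α w j → p w i = p w j → c w i ≠ c w j :=
    fun c hc w hw i j hij _ _ heq => hij (hc.1 w hw (by simp only [heq]))
  -- ★ (X1) at `p` with the model `H c := Br c * K * Hm (A c)`
  refine exists_nhds_bddAbove_norm_iteratedFDeriv_orbFamGExt_of_regGModel L α ν' a' S h1 hlit ((hUo.inter hU₀o).mem_nhds ⟨hpU, hpU₀⟩)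
    (fun c => Br c * K * Hm (A c)) (fun c hc hcreg => ?_) n ?_ (fun k hk => ?_)
  · -- `hfac` at the `G`-regular points: the descent identity, the corner bracket and the centring
    obtain ⟨hne, hsin, -⟩ := hoff c hc (hregΩ c hcreg)
    rw [orbFamGExt_of_mem_regG_of_admissible L α ν' a' S hS hcreg, ← mul_assoc, hBr c, hdesc c hc.1 hcreg]
    -- the integrand is the centred one at the tangential point
    have hint : (fun h : Fin m → ↥(unitaryGroupOfForm (starRingEnd ℂ) J) =>
        f (c, fun k => (((h k * ⟨Matrix.GeneralLinearGroup.mkOfDetNeZero !![(1 : ℂ), 1; 1, -1] det_cayleyTwo_ne_zero *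
              circleDiagonal 2 ![Circle.exp (c (e k) 0), Circle.exp (c (e k) 2)] *
              (Matrix.GeneralLinearGroup.mkOfDetNeZero !![(1 : ℂ), 1; 1, -1] det_cayleyTwo_ne_zero)⁻¹, cayley_conj_circleDiagonal_mem_of_eq_over hJ _⟩ * (h k)⁻¹ :
            ↥(unitaryGroupOfForm (starRingEnd ℂ) J)) : GL (Fin 2) ℂ) : Matrix (Fin 2) (Fin 2) ℂ))) =
        fun h => f' ((A c).1, fun k => (((h k * ⟨Matrix.GeneralLinearGroup.mkOfDetNeZero !![(1 : ℂ), 1; 1, -1] det_cayleyTwo_ne_zero *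
              circleDiagonal 2 ![Circle.exp ((A c).2 k), Circle.exp (-((A c).2 k))] *
              (Matrix.GeneralLinearGroup.mkOfDetNeZero !![(1 : ℂ), 1; 1, -1] det_cayleyTwo_ne_zero)⁻¹, cayley_conj_circleDiagonal_mem_of_eq_over hJ _⟩ * (h k)⁻¹ :
            ↥(unitaryGroupOfForm (starRingEnd ℂ) J)) : GL (Fin 2) ℂ) : Matrix (Fin 2) (Fin 2) ℂ)) := by
      funext h
      have hz : ∀ k, ((A c).1 (e k) 0 + (A c).1 (e k) 2) / 2 = (c (e k) 0 + c (e k) 2) / 2 := fun k => by rw [hπ0, hπ2]; ring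
      have hψk : ∀ k, (A c).2 k = (c (e k) 0 - c (e k) 2) / 2 := fun k => by rw [hA2]
      have hvec : ∀ k, (((h k * ⟨Matrix.GeneralLinearGroup.mkOfDetNeZero !![(1 : ℂ), 1; 1, -1] det_cayleyTwo_ne_zero *
              circleDiagonal 2 ![Circle.exp (c (e k) 0), Circle.exp (c (e k) 2)] *
              (Matrix.GeneralLinearGroup.mkOfDetNeZero !![(1 : ℂ), 1; 1, -1] det_cayleyTwo_ne_zero)⁻¹, cayley_conj_circleDiagonal_mem_of_eq_over hJ _⟩ * (h k)⁻¹ :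
            ↥(unitaryGroupOfForm (starRingEnd ℂ) J)) : GL (Fin 2) ℂ) : Matrix (Fin 2) (Fin 2) ℂ) =
          ((Circle.exp (((A c).1 (e k) 0 + (A c).1 (e k) 2) / 2) : Circle) : ℂ) •
            (((h k * ⟨Matrix.GeneralLinearGroup.mkOfDetNeZero !![(1 : ℂ), 1; 1, -1] det_cayleyTwo_ne_zero *
              circleDiagonal 2 ![Circle.exp ((A c).2 k), Circle.exp (-((A c).2 k))] *
              (Matrix.GeneralLinearGroup.mkOfDetNeZero !![(1 : ℂ), 1; 1, -1] det_cayleyTwo_ne_zero)⁻¹, cayley_conj_circleDiagonal_mem_of_eq_over hJ _⟩ * (h k)⁻¹ :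
            ↥(unitaryGroupOfForm (starRingEnd ℂ) J)) : GL (Fin 2) ℂ) : Matrix (Fin 2) (Fin 2) ℂ) := by
        intro k
        refine coe_conj_cayleyTorus_eq_smul hJ (h k) _ _ _ ?_
        have h0 : Circle.exp (c (e k) 0) = Circle.exp ((c (e k) 0 + c (e k) 2) / 2) * Circle.exp ((c (e k) 0 - c (e k) 2) / 2) := by
          rw [← Circle.exp_add]; congr 1; ring
        have h2 : Circle.exp (c (e k) 2) = Circle.exp ((c (e k) 0 + c (e k) 2) / 2) * Circle.exp (-((c (e k) 0 - c (e k) 2) / 2)) := by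
          rw [← Circle.exp_add]; congr 1; ring
        rw [hz k, hψk k]
        funext i
        fin_cases i
        · exact h0
        · exact h2
      simp only [hf'def]
      rw [htan (A c).1 c _ (fun w hw => hπoff c w hw) (fun k => hπ1 c k)]
      exact congrArg f (Prod.ext rfl (funext fun k => hvec k))
    rw [hint]
    simp only [hHmdef, hA2, Complex.real_smul, Complex.ofReal_prod, Complex.ofReal_mul, Complex.ofReal_ofNat]
    ring
  · -- `hHs`: smooth off the walls near `p`
    have hmaps : MapsTo A ((U ∩ U₀) ∩ {c | ∀ w, w ∉ S → ∀ i j : Fin 3, i ≠ j → slotSign L α w i ≠ slotSign L α w j → p w i = p w j → c w i ≠ c w j})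
        (Q ×ˢ Set.pi univ fun _ : Fin m => {ψ : ℝ | Real.sin ψ ≠ 0}) := fun c hc => (hoff c hc.1 hc.2).2.2
    have h1 : ContDiffOn ℝ n (fun c => Hm (A c)) ((U ∩ U₀) ∩ {c | ∀ w, w ∉ S → ∀ i j : Fin 3, i ≠ j → slotSign L α w i ≠ slotSign L α w j → p w i = p w j → c w i ≠ c w j}) :=
      (hsm.of_le (mod_cast le_top)).comp A.contDiff.contDiffOn hmaps
    have h2 : ContDiffOn ℝ n (fun c => Br c * K) ((U ∩ U₀) ∩ {c | ∀ w, w ∉ S → ∀ i j : Fin 3, i ≠ j → slotSign L α w i ≠ slotSign L α w j → p w i = p w j → c w i ≠ c w j}) :=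
      ((hBrs.of_le (mod_cast le_top)).mono fun c hc => hU₀S c hc.1.2).mul contDiffOn_const
    exact h2.mul h1
  · -- `hHb`: Leibniz with the smooth `Br · K` against the pulled-back tower jets
    have hb : ∀ k' ≤ k, ∃ U' ∈ 𝓝 p, BddAbove ((fun c => ‖iteratedFDeriv ℝ k' (fun c => Hm (A c)) c‖) '' (U' ∩ O)) := by
      intro k' _
      obtain ⟨B, hB⟩ := hbd k'
      refine ⟨A ⁻¹' (Metric.ball p r ×ˢ Metric.ball (0 : Fin m → ℝ) (1 / 2)), A.continuous.continuousAt.preimage_mem_nhds (by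
        rw [hAp]; exact prod_mem_nhds (Metric.ball_mem_nhds p hr) (Metric.ball_mem_nhds _ one_half_pos)), ‖A‖ ^ k' * B, ?_⟩
      rintro _ ⟨c, ⟨hcU, hcO⟩, rfl⟩
      have hcO' : A c ∈ Q ×ˢ Set.pi univ fun _ : Fin m => {ψ : ℝ | Real.sin ψ ≠ 0} := hcO
      refine (norm_iteratedFDeriv_comp_clm_le_of_isOpen A hQT (hsm.of_le (mod_cast le_top)) (n := k') hcO').trans
        (mul_le_mul_of_nonneg_left (hB (A c) ⟨Metric.ball_subset_closedBall hcU.1, fun j _ => ⟨hcO'.2 j (mem_univ _), ?_⟩⟩) (pow_nonneg (norm_nonneg _) _))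
      have h2 : ‖(A c).2‖ < 1 / 2 := by have h := hcU.2; rwa [Metric.mem_ball, dist_zero_right] at h
      have hj := (pi_norm_lt_iff one_half_pos).1 h2 j
      rw [Real.norm_eq_abs, abs_lt] at hj
      exact ⟨hj.1.le, hj.2.le⟩
    have hVf : IsOpen {c : {w : InfinitePlace L // IsComplex w} → Fin 3 → ℝ | ∀ w ∈ S, c w 0 ≠ 0} := ArchCartan.isOpen_setOf_forall_mem_apply_ne_zero S
    obtain ⟨U', hU', hBdd⟩ := exists_nhds_bddAbove_norm_iteratedFDeriv_mul_of_contDiffOn hVf hsplit (hBrs.mul contDiffOn_const) hOo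
      (((hsm.of_le (mod_cast le_top)).comp A.contDiff.contDiffOn fun c hc => hc) : ContDiffOn ℝ k (fun c => Hm (A c)) O) hb
    refine ⟨U' ∩ (U ∩ U₀), inter_mem hU' ((hUo.inter hU₀o).mem_nhds ⟨hpU, hpU₀⟩), hBdd.mono (image_mono ?_)⟩
    rintro c ⟨⟨hcU', hcU⟩, hΩ⟩
    exact ⟨hcU', (hoff c hcU hΩ).2.2⟩


end Model

/-! ## ED. 2 (append-only) — THE GENERIC TWO-PLACE CORNER, HYPOTHESIS-FREE: Layer A fed by ★ (X2) `exists_descent_twoBlock_box_chartOrbG_pi` (LH3-p04 (g4), m = 2) -/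

section TwoCorner

variable (L : Type) [Field L] [NumberField L] [IsCMField L] (α : Fin 3 → L)
  [MeasurableSpace ↥(arch (↥(maximalRealSubfield L)) L (IsCMField.complexConj L) 3 (Matrix.diagonal α))]
  [BorelSpace ↥(arch (↥(maximalRealSubfield L)) L (IsCMField.complexConj L) 3 (Matrix.diagonal α))]
  (ν' : Measure ↥(arch (↥(maximalRealSubfield L)) L (IsCMField.complexConj L) 3 (Matrix.diagonal α))) [ν'.IsHaarMeasure] [ν'.IsMulRightInvariant]

/-- **(I₁) AT A GENERIC TWO-PLACE CORNER OFF THE REAL WALLS — HYPOTHESIS-FREE (ED. 2).**  At a point `p` with `(0,2)`-coincidences at two distinct compact split-chart places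
`w₁, w₂ ∉ S` (third eigenvalue off at both), `G`-REGULAR at every other compact place and off the real walls at the split places, every jet of `orbFamGExt ν′ a′ S` (`a′ ∈ C_c^∞`,
`S` admissible) is bounded near `p` on `InRegG`: ★ (X2) `exists_descent_twoBlock_box_chartOrbG_pi` (LH3-p04) read as the `m = 2` instance (`e := ![w₁, w₂]`, `f′ (c, X) := f (c, (X 0, X 1))`,
block support a ball containing both projections of `C`) of the (X2) block of §3 `exists_nhds_bddAbove_norm_iteratedFDeriv_orbFamGExt_of_cornerDescent`.  (The general-`m` and the
in-regular (`hinreg`) base points wait on (X2) ED. 2; compact coincidences elsewhere are excluded here only because ★ p851307 asks `hreg`.)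
[cite: Varadarajan1977, Part I §1.12] [cite: Bouaziz1994IntegralesOrbitales, §3.1 (I₁)–(I₂) p. 579; §3.2 p. 580] [cite: Shelstad1979, §4 pp. 22–25] [cite: Rogawski1990, §8.2 pp. 118–124] -/
theorem exists_nhds_bddAbove_norm_iteratedFDeriv_orbFamGExt_of_twoCorner (hα : ∀ i, α i ≠ 0)
    (hreal : ∀ (w : {w : InfinitePlace L // IsComplex w}) (i : Fin 3), (w.1.embedding (α i)).im = 0)
    {J : Matrix (Fin 2) (Fin 2) ℂ} (hJ : J = (StdForm.antidiagonal 2).over ℂ)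
    [MeasurableSpace ↥(unitaryGroupOfForm (starRingEnd ℂ) J)] [BorelSpace ↥(unitaryGroupOfForm (starRingEnd ℂ) J)]
    [LocallyCompactSpace ↥(unitaryGroupOfForm (starRingEnd ℂ) J)] [SecondCountableTopology ↥(unitaryGroupOfForm (starRingEnd ℂ) J)]
    (μ₀ : Measure ↥(unitaryGroupOfForm (starRingEnd ℂ) J)) [μ₀.IsHaarMeasure] [μ₀.IsMulRightInvariant]
    {S : Finset {w : InfinitePlace L // IsComplex w}} {w₁ w₂ : {w : InfinitePlace L // IsComplex w}} {p : {w : InfinitePlace L // IsComplex w} → Fin 3 → ℝ}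
    (hS : ∀ w, w ∈ S → w ∈ splitChartPlaces L α) (hw₁ : w₁ ∉ S) (hw₂ : w₂ ∉ S) (h12 : w₁ ≠ w₂)
    (hw₁sp : w₁ ∈ splitChartPlaces L α) (hw₂sp : w₂ ∈ splitChartPlaces L α)
    (h02₁ : p w₁ 0 = p w₁ 2) (h01₁ : Circle.exp (p w₁ 0) ≠ Circle.exp (p w₁ 1))
    (h02₂ : p w₂ 0 = p w₂ 2) (h01₂ : Circle.exp (p w₂ 0) ≠ Circle.exp (p w₂ 1))
    (hreg : ∀ w, w ≠ w₁ → w ≠ w₂ → w ∉ S → Function.Injective fun i : Fin 3 => Circle.exp (p w i)) (hregS : ∀ w, w ∈ S → p w 0 ≠ 0)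
    {a' : ↥(arch (↥(maximalRealSubfield L)) L (IsCMField.complexConj L) 3 (Matrix.diagonal α)) → ℂ} (ha' : ArchSmooth L 3 (Matrix.diagonal α) a') (n : ℕ) :
    ∃ U' ∈ 𝓝 p, BddAbove ((fun c => ‖iteratedFDeriv ℝ n (orbFamGExt L α ν' a' S) c‖) '' (U' ∩ InRegG (slotSign L α) S)) := by
  obtain ⟨K, U, f, -, hUo, hpU, hf, ⟨C, hC, hfC⟩, htan, hid⟩ :=
    exists_descent_twoBlock_box_chartOrbG_pi L α ν' hα hreal hJ μ₀ hS hw₁ hw₂ h12 hw₁sp hw₂sp h02₁ h01₁ h02₂ h01₂ hreg hregS ha'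
  -- the two corner places as an enumeration `e : Fin 2 ↪ W`
  let e : Fin 2 ↪ {w : InfinitePlace L // IsComplex w} := ⟨![w₁, w₂], fun i j hij => by
    fin_cases i <;> fin_cases j
    · rfl
    · exact absurd hij h12
    · exact absurd hij.symm h12
    · rfl⟩
  have he0 : e 0 = w₁ := rfl
  have he1 : e 1 = w₂ := rfl
  have hrange : ∀ w, w ∉ Set.range e → w ≠ w₁ ∧ w ≠ w₂ := fun w hw =>
    ⟨fun h => hw ⟨0, by rw [he0, h]⟩, fun h => hw ⟨1, by rw [he1, h]⟩⟩
  -- the block function on `Fin 2 → M₂(ℂ)` and its compact support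
  obtain ⟨R, hR⟩ := hC.isBounded.subset_closedBall (0 : Matrix (Fin 2) (Fin 2) ℂ × Matrix (Fin 2) (Fin 2) ℂ)
  refine exists_nhds_bddAbove_norm_iteratedFDeriv_orbFamGExt_of_cornerDescent L α ν' hJ μ₀ hS e
    (fun k => by fin_cases k <;> assumption) (fun k => (slotSign_zero_ne_two_of_mem_splitChartPlaces L α hα (by fin_cases k <;> assumption)).1)
    (fun k => by fin_cases k <;> assumption) (fun k => by fin_cases k <;> [exact h01₁.symm; exact h01₂.symm])
    (fun w hw hwe i j hij _ heq => hij ((hreg w (hrange w hwe).1 (hrange w hwe).2 hw) heq)) hregS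
    (contDiffOn_orbFamGExt_inRegG L α ν' S hα hreal hS ha') K hUo hpU (fun z => f (z.1, (z.2 0, z.2 1)))
    (hf.comp (contDiff_fst.prodMk (((contDiff_apply ℝ (Matrix (Fin 2) (Fin 2) ℂ) 0).comp contDiff_snd).prodMk
      ((contDiff_apply ℝ (Matrix (Fin 2) (Fin 2) ℂ) 1).comp contDiff_snd))))
    (isCompact_closedBall (0 : Matrix (Fin 2) (Fin 2) ℂ) R) (fun c X hX => ?_) (fun c c' X hoff h1 => ?_) (fun c hcU hcreg => ?_) n
  · -- support: if one block variable leaves the ball, the pair leaves `C`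
    refine hfC c _ fun hmem => ?_
    obtain ⟨k, hk⟩ := hX
    have h := hR hmem
    rw [Metric.mem_closedBall, dist_zero_right] at h
    apply hk
    rw [Metric.mem_closedBall, dist_zero_right]
    fin_cases k
    · exact (norm_fst_le _).trans h
    · exact (norm_snd_le _).trans h
  · -- tangential clause from the double update
    rw [htan c, htan c']
    congr 2
    funext w
    by_cases hw2 : w = w₂
    · rw [hw2]; simp only [Function.update_self]; rw [show c w₂ 1 = c' w₂ 1 from h1 1]
    · rw [Function.update_of_ne hw2, Function.update_of_ne hw2]
      by_cases hw1 : w = w₁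
      · rw [hw1]; simp only [Function.update_self]; rw [show c w₁ 1 = c' w₁ 1 from h1 0]
      · rw [Function.update_of_ne hw1, Function.update_of_ne hw1]
        refine hoff w fun ⟨k, hk⟩ => ?_
        fin_cases k
        · exact hw1 (hk.symm.trans he0)
        · exact hw2 (hk.symm.trans he1)
  · -- the descent identity, re-indexed by `e`
    rw [hid c ⟨hcU, hcreg⟩]
    rfl

end TwoCorner

end Literature.NumberTheory.Rogawski1990

end
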